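import Summits.BirchSwinnertonDyer.Rank1Residual.P2.CongruentNumberSilentEvenFiveEnclosureAut
import Summits.BirchSwinnertonDyer.Rank1Residual.P2.CongruentNumberSilentEvenFiveRankDescentParam
import Summits.BirchSwinnertonDyer.Rank1Residual.P2.CongruentNumberSilentEvenFiveEnclosureSelmerBound
import Literature.NumberTheory.EllipticCurves.CongruentNumberEvenFiveSelmerBound
import HarnessLib

/-!
# Cell `bsd-monsky`, route A: C-P2-1 on `𝒮⁻` from the CM-point system display ALONE — the `2`-Selmer input
# discharged by the tree's complete `2`-descent (`#Sel⁽²⁾(E_{2pq}/ℚ) ≤ 8` is a kernel theorem)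

HONEST FRAMING (cell `bsd-monsky`, run/shared/lean/pub/bsd-monsky/; README §1): ONE theorem on ONE explicit
infinite family of quadratic twists of the congruent number curve at the prime `2`; not "BSD for rank ≤ 1",
nothing at odd primes; nothing is booked by this file. Every corner of route A's enclosure took TWO displayed
inputs: Tian's CM-point system on `X₀(32)` in one of its forms (`hSys`, `hSys′` genus, `hSys″` split, `hSys‴`
bridged, `hSys⁗` maximal, `hSys⁵` cusp, `hSys⁶` param, `hSys⁷` aut) and ONE `2`-Selmer input (Aoki 1999 Thm. 2.2
`hAo` | Monsky's appendix to Heath-Brown 1994 `hMe` | Monsky 1990 Cor. 5.15 `h515` | the in-house bound `hD`).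
The bound `hD : #Sel₂(E_{2pq}) ≤ 8` on `𝒮⁻` is now the tree theorem
`Literature.NumberTheory.EllipticCurves.card_selmerGroup_two_le_eight_congruentNumberCurve_two_mul_of_jacobiSym_eq_neg_one`
(`CongruentNumberEvenFiveSelmerBound.lean`: complete `2`-descent on SELMER classes — Silverman AEC X.1.4 /
X.4.9 on the tree's cohomological `Sel⁽²⁾` through the descent–Selmer bridge
`TwoDescentKummerBridge{,Local,GoodPlace,Rat,AdditivePlace,RealPlace}.lean`; seven `𝔽₂`-coordinates, four
relations from the places `p`, `q`, `∞` and the good primes; no `2`-adic condition), so on every corner the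
second input leaves: **C-P2-1 = Theorem 1.1 on `𝒮⁻` relative to the system display ALONE**
(`…_of_system_descent (hSys)`, `…_of_genusSystem_descent (hSys′)`, `…_of_maximalSystem_descent (hSys⁗)`,
`…_of_cuspSystem_descent (hSys⁵)`, `…_of_paramSystem_descent (hSys⁶)`, `…_of_autSystem_descent (hSys⁷)`), each
a one-line composition of `…EnclosureSelmerBound.lean`'s `…_of_genusSystem_of_selmer_le_eight` / `…_of_system_of_selmer_le_eight`
with the descent theorem and the landed converters `tian2014_system_sMinus_*_of_*`. The corner of record (referee B
ROUND 375) is `{hAo, hSys⁷}` → here `hSys⁷` alone: `congruentSilentEvenFiveBSDTwo_of_autSystem_descent`.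
CONDITIONAL on the one system display; nothing asserted; the conjecture `Prop`s stay `@[conjecture]`; no mark moved.
[cite: Tian2014, Thm. 2.8 (J132), Def. 2.7, Prop. 2.1, p0003 L3–L5 (J119), J124–J126]
[cite: TianYuanZhang2017, Thm. 3.3 (p. 739), p. 749, J733, J741, J747, J751, Lemma 3.16 (J754)]
[cite: SilvermanAEC2009, Prop. X.1.4, Prop. X.4.9, Thm. X.4.2] [cite: Miller2011LMS, Def. 1.1 (arXiv:1010.2431 p. 3)]
-/

noncomputable section

open scoped Classical

open WeierstrassCurve Literature.NumberTheory.EllipticCurves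
  Literature.NumberTheory.EllipticCurves.Rank1Residual.Typed

set_option autoImplicit false

namespace Summit.BirchSwinnertonDyer.Rank1Residual.P2

open Conjectures Literature.NumberTheory.EllipticCurves.Tian2014

/-! ## §1 C-P2-1 on `𝒮⁻` from the system display ALONE (the datum itself is `oddIndexHeegnerDatum_of_system_rankDescent`,
the bound `hD` in binder shape is `selmer_le_eight_sMinus` of `…ThetaCMDescent.lean`; here the Literature theorem is inlined) -/

/-- **C-P2-1 = Theorem 1.1 on `𝒮⁻` from `hSys` ALONE** (`tian2014_monsky1990_system_sMinus`; the `2`-Selmer input is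
the tree's `2`-descent theorem). CONDITIONAL; nothing asserted. [cite: Tian2014, Thm. 2.8 (arXiv:1210.8231 p0011 L25–L44)]
[cite: TianYuanZhang2017, Thm. 3.3] [cite: SilvermanAEC2009, Prop. X.1.4, Prop. X.4.9, Thm. X.4.2] [cite: Miller2011LMS, Def. 1.1 (arXiv:1010.2431 p. 3)] -/
theorem congruentSilentEvenFiveBSDTwo_of_system_descent (hSys : tian2014_monsky1990_system_sMinus) :
    CongruentSilentEvenFiveBSDTwo :=
  congruentSilentEvenFiveBSDTwo_of_system_of_selmer_le_eight
    (fun _ _ hp hq hp5 hq4 hj =>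
      card_selmerGroup_two_le_eight_congruentNumberCurve_two_mul_of_jacobiSym_eq_neg_one hp hq hp5 hq4 hj) hSys

/-- **C-P2-1 on `𝒮⁻` from the genus form `hSys′` ALONE.** CONDITIONAL; nothing asserted.
[cite: Tian2014, Thm. 2.8 (arXiv:1210.8231 p0011 L25–L44)] [cite: TianYuanZhang2017, Thm. 3.3]
[cite: SilvermanAEC2009, Prop. X.1.4, Prop. X.4.9, Thm. X.4.2] [cite: Miller2011LMS, Def. 1.1 (arXiv:1010.2431 p. 3)] -/
theorem congruentSilentEvenFiveBSDTwo_of_genusSystem_descent (hSys : tian2014_system_sMinus_genus) :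
    CongruentSilentEvenFiveBSDTwo :=
  congruentSilentEvenFiveBSDTwo_of_genusSystem_of_selmer_le_eight
    (fun _ _ hp hq hp5 hq4 hj =>
      card_selmerGroup_two_le_eight_congruentNumberCurve_two_mul_of_jacobiSym_eq_neg_one hp hq hp5 hq4 hj) hSys

/-- **C-P2-1 on `𝒮⁻` from the split form `hSys″` ALONE.** CONDITIONAL; nothing asserted.
[cite: TianYuanZhang2017, Thm. 3.3 (p. 739), p. 749] [cite: SilvermanAEC2009, Prop. X.1.4, Prop. X.4.9, Thm. X.4.2]
[cite: Miller2011LMS, Def. 1.1 (arXiv:1010.2431 p. 3)] -/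
theorem congruentSilentEvenFiveBSDTwo_of_splitSystem_descent (hSys : tian2014_system_sMinus_split) :
    CongruentSilentEvenFiveBSDTwo :=
  congruentSilentEvenFiveBSDTwo_of_genusSystem_descent (tian2014_system_sMinus_genus_of_split hSys)

/-- **C-P2-1 on `𝒮⁻` from the bridged form `hSys‴` ALONE.** CONDITIONAL; nothing asserted.
[cite: TianYuanZhang2017, Thm. 3.3 (p. 739), p. 749] [cite: SilvermanAEC2009, Prop. X.1.4, Prop. X.4.9, Thm. X.4.2]
[cite: Miller2011LMS, Def. 1.1 (arXiv:1010.2431 p. 3)] -/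
theorem congruentSilentEvenFiveBSDTwo_of_bridgedSystem_descent (hSys : tian2014_system_sMinus_bridged) :
    CongruentSilentEvenFiveBSDTwo :=
  congruentSilentEvenFiveBSDTwo_of_splitSystem_descent (tian2014_system_sMinus_split_of_bridged hSys)

/-- **C-P2-1 on `𝒮⁻` from the MAXIMAL form `hSys⁗` ALONE.** CONDITIONAL; nothing asserted.
[cite: Tian2014, Def. 2.7, Prop. 2.1, p0003 L3–L5 (J119)] [cite: TianYuanZhang2017, Thm. 3.3 (p. 739), p. 749, J733, J741, J747, J751, Lemma 3.16 (J754)]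
[cite: SilvermanAEC2009, Prop. X.1.4, Prop. X.4.9, Thm. X.4.2] [cite: Miller2011LMS, Def. 1.1 (arXiv:1010.2431 p. 3)] -/
theorem congruentSilentEvenFiveBSDTwo_of_maximalSystem_descent (hSys : tian2014_system_sMinus_maximal) :
    CongruentSilentEvenFiveBSDTwo :=
  congruentSilentEvenFiveBSDTwo_of_bridgedSystem_descent (tian2014_system_sMinus_bridged_of_maximal hSys)

/-- **C-P2-1 on `𝒮⁻` from the CUSP form `hSys⁵` ALONE.** CONDITIONAL; nothing asserted.
[cite: Tian2014, Def. 2.7, Prop. 2.1, p0003 L3–L5 (J119)] [cite: TianYuanZhang2017, Thm. 3.3 (p. 739), p. 749, J733, J741, J747, J751, Lemma 3.16 (J754)]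
[cite: SilvermanAEC2009, Prop. X.1.4, Prop. X.4.9, Thm. X.4.2] [cite: Miller2011LMS, Def. 1.1 (arXiv:1010.2431 p. 3)] -/
theorem congruentSilentEvenFiveBSDTwo_of_cuspSystem_descent (hSys : tian2014_system_sMinus_cusp) :
    CongruentSilentEvenFiveBSDTwo :=
  congruentSilentEvenFiveBSDTwo_of_maximalSystem_descent (tian2014_system_sMinus_maximal_of_cusp hSys)

/-- **C-P2-1 on `𝒮⁻` from the PARAM form `hSys⁶` ALONE** (the corner of referee B's ROUND 338, now without Aoki).
CONDITIONAL; nothing asserted. [cite: Tian2014, Thm. 2.8 (J132), Def. 2.7, Prop. 2.1, p0003 L3–L5 (J119)]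
[cite: TianYuanZhang2017, Thm. 3.3 (p. 739), p. 749, J733, J741, J747, J751, Lemma 3.16 (J754)]
[cite: SilvermanAEC2009, Prop. X.1.4, Prop. X.4.9, Thm. X.4.2] [cite: Miller2011LMS, Def. 1.1 (arXiv:1010.2431 p. 3)] -/
theorem congruentSilentEvenFiveBSDTwo_of_paramSystem_descent (hSys : tian2014_system_sMinus_param) :
    CongruentSilentEvenFiveBSDTwo :=
  congruentSilentEvenFiveBSDTwo_of_maximalSystem_descent (tian2014_system_sMinus_maximal_of_param hSys)

/-- **C-P2-1 = Theorem 1.1 on `𝒮⁻` from the AUT form `hSys⁷` ALONE** — the corner of record (referee B ROUND 375,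
`{hAo, hSys⁷}`) with the `2`-Selmer input DISCHARGED by the tree's complete `2`-descent: relative to the ONE system
display, every displayed hypothesis of route A a printed sentence or a one-line reading; no Aoki, no HB94, no Monsky
1990. CONDITIONAL on the system display; nothing asserted. [cite: Tian2014, Thm. 2.8 (J132), Def. 2.7, Prop. 2.1, p0003 L3–L5 (J119), J124–J126]
[cite: TianYuanZhang2017, Thm. 3.3 (p. 739), p. 749, J733, J741, J747, J751, Lemma 3.16 (J754)]
[cite: SilvermanAEC2009, Prop. X.1.4, Prop. X.4.9, Thm. X.4.2] [cite: Miller2011LMS, Def. 1.1 (arXiv:1010.2431 p. 3)] -/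
theorem congruentSilentEvenFiveBSDTwo_of_autSystem_descent (hSys : tian2014_system_sMinus_aut) :
    CongruentSilentEvenFiveBSDTwo :=
  congruentSilentEvenFiveBSDTwo_of_maximalSystem_descent (tian2014_system_sMinus_maximal_of_aut hSys)

/-! ## §2 Both typed forms from the system display alone (the sharper form was already Selmer-free via `…RankDescent`) -/

/-- **Both typed forms of C-P2-1 on `𝒮⁻` from `hSys⁷` ALONE.** CONDITIONAL; nothing asserted.
[cite: Tian2014, Def. 2.7, Prop. 2.1, p0003 L3–L5 (J119), J124–J126] [cite: TianYuanZhang2017, Thm. 3.3, J733, J741, J747, J751, Lemma 3.16 (J754)]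
[cite: SilvermanAEC2009, Prop. X.1.4, Prop. X.4.9] [cite: Miller2011LMS, Def. 1.1] -/
theorem congruentSilentEvenFive_pair_of_autSystem_descent (hSys : tian2014_system_sMinus_aut) :
    CongruentSilentEvenFiveOrdTwo ∧ CongruentSilentEvenFiveBSDTwo :=
  ⟨congruentSilentEvenFiveOrdTwo_of_autSystem_rankDescent hSys, congruentSilentEvenFiveBSDTwo_of_autSystem_descent hSys⟩

/-- **Both typed forms of C-P2-1 on `𝒮⁻` from `hSys⁶` ALONE.** CONDITIONAL; nothing asserted.
[cite: Tian2014, Def. 2.7, Prop. 2.1, p0003 L3–L5 (J119)] [cite: TianYuanZhang2017, Thm. 3.3, J733, J741, J747, J751, Lemma 3.16 (J754)]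
[cite: SilvermanAEC2009, Prop. X.1.4, Prop. X.4.9] [cite: Miller2011LMS, Def. 1.1] -/
theorem congruentSilentEvenFive_pair_of_paramSystem_descent (hSys : tian2014_system_sMinus_param) :
    CongruentSilentEvenFiveOrdTwo ∧ CongruentSilentEvenFiveBSDTwo :=
  ⟨congruentSilentEvenFiveOrdTwo_of_paramSystem_rankDescent hSys, congruentSilentEvenFiveBSDTwo_of_paramSystem_descent hSys⟩

/-- **Both typed forms of C-P2-1 on `𝒮⁻` from `hSys⁗` ALONE.** CONDITIONAL; nothing asserted.
[cite: Tian2014, Def. 2.7, Prop. 2.1] [cite: TianYuanZhang2017, Thm. 3.3, J733, J741, J747, J751, Lemma 3.16 (J754)]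
[cite: SilvermanAEC2009, Prop. X.1.4, Prop. X.4.9] [cite: Miller2011LMS, Def. 1.1] -/
theorem congruentSilentEvenFive_pair_of_maximalSystem_descent (hSys : tian2014_system_sMinus_maximal) :
    CongruentSilentEvenFiveOrdTwo ∧ CongruentSilentEvenFiveBSDTwo :=
  ⟨congruentSilentEvenFiveOrdTwo_of_maximalSystem_rankDescent hSys,
    congruentSilentEvenFiveBSDTwo_of_maximalSystem_descent hSys⟩

/-- **Both typed forms of C-P2-1 on `𝒮⁻` from `hSys` ALONE.** CONDITIONAL; nothing asserted.
[cite: Tian2014, Thm. 2.8 (arXiv:1210.8231 p0011 L25–L44)] [cite: TianYuanZhang2017, Thm. 3.3]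
[cite: SilvermanAEC2009, Prop. X.1.4, Prop. X.4.9] [cite: Miller2011LMS, Def. 1.1] -/
theorem congruentSilentEvenFive_pair_of_system_descent (hSys : tian2014_monsky1990_system_sMinus) :
    CongruentSilentEvenFiveOrdTwo ∧ CongruentSilentEvenFiveBSDTwo :=
  ⟨congruentSilentEvenFiveOrdTwo_of_system_rankDescent hSys, congruentSilentEvenFiveBSDTwo_of_system_descent hSys⟩

end Summit.BirchSwinnertonDyer.Rank1Residual.P2

end
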